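import Summits.RiemannHypothesis.RiemannHypothesis.Theorems.TiltedLandingLaw421R2CoreP

/-!
# `TiltedLandingLaw421` (crux stmt-RiemannHypothesis-24774) — negative-side support, part 1: the datum D\*

The explicit polynomial witness behind `AlphaSealTrkDFalse.lean` (same folder): `fW z = z⁵ + z³ = z³(z² + 1)`
(real entire, zeros `0` triple and `±i` simple, non-real critical points `±i√(3/5)`), and the proof that the
W-07 engine frame `RhIdea6.G17.W07C7.Rev6.EngineHyps5 2 η f x₀ s hmax R Hs B` holds at
`(η, f, x₀, s, hmax, R, Hs, B) = (1/2, fW, 0, 23/25, 2, 40, 1, 64)` (`engineHyps5_D`): growth of order `1`,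
`2s ≤ hmax`, `2hmax ≤ R`, `3hmax < R`, zeros in `|Im| ≤ 1 = Hs`, `w₀ = i`, column budget (zero mass `5`),
half-slab budgets (empty half-slabs, `r/s ≤ 1000/23`), `RemainderBox` (remainder identically `0` for `|Re w| < 20`,
near set empty and `‖f′/f‖ ≤ 25/46 = η/s` for `|Re w| = 20`). `sorry`-free, standard axioms; filed
`--supports stmt-RiemannHypothesis-24774` by the W-07/W-08 critic of record (rh-split-ref-2 g20), cert
`RESULT-7-alpha-kill-g20.md` sha16 f6150880174abb77. Nothing here bears on the truth of RH; a polynomial is not `ξ`.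
-/

set_option linter.dupNamespace false  -- the mandated namespace repeats `RiemannHypothesis`

namespace Summit.RiemannHypothesis.RiemannHypothesis.Theorems.TiltedLandingLaw421.Negative

open Complex Set Filter

/-- The witness function `f(z) = z⁵ + z³ = z³ (z² + 1)` (zeros: `0` of order 3, `±i` simple). -/
def fW (z : ℂ) : ℂ := z ^ 5 + z ^ 3

/-- its derivative -/
def fW1 (z : ℂ) : ℂ := 5 * z ^ 4 + 3 * z ^ 2

/-- its second derivative -/
def fW2 (z : ℂ) : ℂ := 20 * z ^ 3 + 6 * z

/-- `fW' = fW1` pointwise. -/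
theorem hasDerivAt_fW (z : ℂ) : HasDerivAt fW (fW1 z) z := by
  have h5 : HasDerivAt (fun x : ℂ => x ^ 5) (5 * z ^ 4) z := by simpa using hasDerivAt_pow 5 z
  have h3 : HasDerivAt (fun x : ℂ => x ^ 3) (3 * z ^ 2) z := by simpa using hasDerivAt_pow 3 z
  exact h5.add h3

/-- `fW1' = fW2` pointwise. -/
theorem hasDerivAt_fW1 (z : ℂ) : HasDerivAt fW1 (fW2 z) z := by
  have h4 : HasDerivAt (fun x : ℂ => 5 * x ^ 4) (5 * (4 * z ^ 3)) z := by
    simpa using (hasDerivAt_pow 4 z).const_mul 5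
  have h2 : HasDerivAt (fun x : ℂ => 3 * x ^ 2) (3 * (2 * z)) z := by
    simpa using (hasDerivAt_pow 2 z).const_mul 3
  have h := h4.add h2
  have e : 5 * (4 * z ^ 3) + 3 * (2 * z) = fW2 z := by unfold fW2; ring
  rw [e] at h
  exact h

/-- `deriv fW = fW1`. -/
theorem deriv_fW : deriv fW = fW1 := funext fun z => (hasDerivAt_fW z).deriv

/-- `deriv fW1 = fW2`. -/
theorem deriv_fW1 : deriv fW1 = fW2 := funext fun z => (hasDerivAt_fW1 z).deriv

/-- `fW` is entire. -/
theorem differentiable_fW : Differentiable ℂ fW := fun z => (hasDerivAt_fW z).differentiableAt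


/-- `fW⁽⁰⁾ = fW`. -/
theorem iteratedDeriv_zero_fW : iteratedDeriv 0 fW = fW := iteratedDeriv_zero

/-- `fW⁽¹⁾ = fW1`. -/
theorem iteratedDeriv_one_fW : iteratedDeriv 1 fW = fW1 := by rw [iteratedDeriv_one, deriv_fW]

/-- `fW⁽²⁾ = fW2`. -/
theorem iteratedDeriv_two_fW : iteratedDeriv 2 fW = fW2 := by
  rw [show (2 : ℕ) = 1 + 1 from rfl, iteratedDeriv_succ, iteratedDeriv_one_fW, deriv_fW1]


/-- `fW z = z³ (z − i)(z + i)`. -/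
theorem fW_factor (z : ℂ) : fW z = z ^ 3 * ((z - I) * (z + I)) := by
  unfold fW; linear_combination (z ^ 3) * I_mul_I

/-- the zero set of `fW` is `{0, i, −i}`. -/
theorem fW_eq_zero_iff (z : ℂ) : fW z = 0 ↔ z = 0 ∨ z = I ∨ z = -I := by
  rw [fW_factor, mul_eq_zero, mul_eq_zero, pow_eq_zero_iff (by norm_num), sub_eq_zero,
    add_eq_zero_iff_eq_neg]

/-- `fW i = 0`. -/
theorem fW_I : fW I = 0 := (fW_eq_zero_iff I).2 (Or.inr (Or.inl rfl))
/-- `fW (−i) = 0`. -/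
theorem fW_negI : fW (-I) = 0 := (fW_eq_zero_iff (-I)).2 (Or.inr (Or.inr rfl))
/-- `fW 0 = 0`. -/
theorem fW_zero : fW 0 = 0 := (fW_eq_zero_iff 0).2 (Or.inl rfl)
/-- `fW 1 = 2`. -/
theorem fW_one : fW 1 = 2 := by unfold fW; norm_num

/-- `fW` is not the zero function. -/
theorem fW_ne_zero : fW ≠ 0 := fun h => by
  have := congrFun h 1; rw [fW_one] at this; norm_num at this

/-- `fW1 z = z² (5z² + 3)`. -/
theorem fW1_factor (z : ℂ) : fW1 z = z ^ 2 * (5 * z ^ 2 + 3) := by unfold fW1; ring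

/-- the real zeros structure of `fW1`: a zero with positive imaginary part has `re = 0`, `im² = 3/5`. -/
theorem fW1_zero_im (z : ℂ) (hz : fW1 z = 0) (him : 0 < z.im) : z.re = 0 ∧ z.im ^ 2 = 3 / 5 := by
  rw [fW1_factor, mul_eq_zero] at hz
  rcases hz with h | h
  · have : z = 0 := pow_eq_zero_iff (by norm_num) |>.1 h
    rw [this] at him; simp at him
  · -- 5 z² + 3 = 0
    have hre := congrArg Complex.re h
    have hi := congrArg Complex.im h
    simp [sq] at hre hi
    -- hre : 5 * (z.re * z.re - z.im * z.im) + 3 = 0 ; hi : 5 * (z.re * z.im + z.im * z.re) = 0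
    have hre0 : z.re = 0 := by
      have : z.re * z.im = 0 := by nlinarith
      rcases mul_eq_zero.1 this with h1 | h1
      · exact h1
      · exact absurd h1 (ne_of_gt him)
    refine ⟨hre0, ?_⟩
    rw [hre0] at hre
    nlinarith


/-- the point `i·√(3/5)`, a non-real zero of `fW1 = fW′` -/
noncomputable def ρW : ℂ := ((Real.sqrt (3 / 5) : ℝ) : ℂ) * I

/-- `Re ρW = 0`. -/
theorem ρW_re : ρW.re = 0 := by simp [ρW]
/-- `Im ρW = √(3/5)`. -/
theorem ρW_im : ρW.im = Real.sqrt (3 / 5) := by simp [ρW]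
/-- `0 < Im ρW`. -/
theorem ρW_im_pos : 0 < ρW.im := by rw [ρW_im]; exact Real.sqrt_pos.2 (by norm_num)
/-- `Im ρW < 1`. -/
theorem ρW_im_lt_one : ρW.im < 1 := by
  rw [ρW_im, Real.sqrt_lt' (by norm_num)]; norm_num

/-- `ρW` is a critical point of `fW`: `fW1 ρW = 0`. -/
theorem fW1_ρW : fW1 ρW = 0 := by
  have hs : ((Real.sqrt (3 / 5) : ℝ) : ℂ) ^ 2 = (3 / 5 : ℂ) := by
    rw [← ofReal_pow, Real.sq_sqrt (by norm_num)]; push_cast; ring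
  unfold fW1 ρW
  have e4 : (((Real.sqrt (3 / 5) : ℝ) : ℂ) * I) ^ 4 = (3 / 5 : ℂ) ^ 2 := by
    have : (((Real.sqrt (3 / 5) : ℝ) : ℂ) * I) ^ 4 = ((((Real.sqrt (3 / 5) : ℝ) : ℂ) * I) ^ 2) ^ 2 := by ring
    rw [this, mul_pow, I_sq, hs]; ring
  have e2 : (((Real.sqrt (3 / 5) : ℝ) : ℂ) * I) ^ 2 = -(3 / 5 : ℂ) := by
    rw [mul_pow, I_sq, hs]; ring
  rw [e4, e2]; ring

/-- analytic orders of `fW` at its zeros -/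
theorem analyticOrderAt_fW_zero : analyticOrderAt fW 0 = (3 : ℕ) := by
  rw [AnalyticAt.analyticOrderAt_eq_natCast (differentiable_fW.analyticAt 0)]
  refine ⟨fun z => (z - I) * (z + I), ?_, ?_, Filter.Eventually.of_forall fun z => ?_⟩
  · apply Differentiable.analyticAt; fun_prop
  · simp
  · rw [fW_factor]; simp

/-- `fW` has a simple zero at `i`. -/
theorem analyticOrderAt_fW_I : analyticOrderAt fW I = (1 : ℕ) := by
  rw [AnalyticAt.analyticOrderAt_eq_natCast (differentiable_fW.analyticAt I)]
  refine ⟨fun z => z ^ 3 * (z + I), ?_, ?_, Filter.Eventually.of_forall fun z => ?_⟩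
  · apply Differentiable.analyticAt; fun_prop
  · show I ^ 3 * (I + I) ≠ 0
    have I_pow_three : I ^ 3 = -I := by rw [pow_succ, I_sq]; ring
    have : I ^ 3 * (I + I) = 2 := by rw [I_pow_three]; linear_combination (-2 : ℂ) * I_mul_I
    rw [this]; norm_num
  · rw [fW_factor]; simp; ring

/-- `fW` has a simple zero at `−i`. -/
theorem analyticOrderAt_fW_negI : analyticOrderAt fW (-I) = (1 : ℕ) := by
  rw [AnalyticAt.analyticOrderAt_eq_natCast (differentiable_fW.analyticAt (-I))]
  refine ⟨fun z => z ^ 3 * (z - I), ?_, ?_, Filter.Eventually.of_forall fun z => ?_⟩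
  · apply Differentiable.analyticAt; fun_prop
  · show (-I) ^ 3 * (-I - I) ≠ 0
    have I_pow_three : I ^ 3 = -I := by rw [pow_succ, I_sq]; ring
    have : (-I) ^ 3 * (-I - I) = 2 := by
      rw [neg_pow, I_pow_three]; linear_combination (-2 : ℂ) * I_mul_I
    rw [this]; norm_num
  · rw [fW_factor]; simp; ring


/-! ## The engine hypotheses `EngineHyps5 2 η f x₀ s hmax R Hs B` at the datum
`(η, f, x₀, s, hmax, R, Hs, B) = (1/2, fW, 0, 23/25, 2, 40, 1, 64)`. -/

open RhIdea6.G17.W07C7 RhIdea6.G17.W07C7.Rev6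


/-- `0 ∉ {i, −i}`. -/
theorem zero_notMem_pair : (0 : ℂ) ∉ ({I, -I} : Finset ℂ) := by
  simp only [Finset.mem_insert, Finset.mem_singleton, not_or]
  exact ⟨fun h => I_ne_zero h.symm, fun h => I_ne_zero (neg_eq_zero.1 h.symm)⟩


/-- the column zero set (every zero of `fW` lies on the column `re = 0`). -/
theorem colSet_eq {r : ℝ} (hr : 0 ≤ r) :
    {u : ℂ | fW u = 0 ∧ |u.re - 0| ≤ r} = ↑({0, I, -I} : Finset ℂ) := by
  ext u
  simp only [Set.mem_setOf_eq, Finset.coe_insert, Finset.coe_singleton, Set.mem_insert_iff,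
    Set.mem_singleton_iff, fW_eq_zero_iff, sub_zero]
  constructor
  · rintro ⟨h, -⟩; exact h
  · intro h; refine ⟨h, ?_⟩; rcases h with rfl | rfl | rfl <;> simp [hr]

/-- total zero mass of `fW`: `3 + 1 + 1 = 5`. -/
theorem orderSum_real : ∑ u ∈ ({0, I, -I} : Finset ℂ), ((analyticOrderAt fW u).toNat : ℝ) = 5 := by
  have I_ne_negI : (I : ℂ) ≠ -I := fun h => I_ne_zero (by linear_combination (1 / 2 : ℂ) * h)
  rw [Finset.sum_insert zero_notMem_pair, Finset.sum_pair I_ne_negI, analyticOrderAt_fW_zero,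
    analyticOrderAt_fW_I, analyticOrderAt_fW_negI]
  simp; norm_num

/-- `ColumnBudgetMult 64 fW 0 (23/25) 40`: the column count `5 − 2r/s ≤ 64`. -/
theorem columnBudget_D : ColumnBudgetMult 64 fW 0 (23 / 25) 40 := by
  intro r hr _
  rw [colSet_eq (by linarith), finsum_mem_coe_finset, orderSum_real]
  have : 0 ≤ 2 * r / (23 / 25) := by positivity
  push_cast; linarith

/-- the right half-slab carries no zero of `fW`. -/
theorem rightSlab_empty (r : ℝ) : {u : ℂ | fW u = 0 ∧ 0 < u.re ∧ u.re ≤ 0 + r} = ∅ := by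
  ext u
  simp only [Set.mem_setOf_eq, Set.mem_empty_iff_false, iff_false, not_and, fW_eq_zero_iff]
  rintro (rfl | rfl | rfl) <;> simp

/-- the left half-slab carries no zero of `fW`. -/
theorem leftSlab_empty (r : ℝ) : {u : ℂ | fW u = 0 ∧ 0 - r ≤ u.re ∧ u.re < 0} = ∅ := by
  ext u
  simp only [Set.mem_setOf_eq, Set.mem_empty_iff_false, iff_false, not_and, fW_eq_zero_iff]
  rintro (rfl | rfl | rfl) <;> simp

/-- `HalfSlabBudget 64 fW 0 (23/25) 40`: `|0 − r/s| ≤ 1000/23 ≤ 65`. -/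
theorem halfSlab_D : HalfSlabBudget 64 fW 0 (23 / 25) 40 := by
  intro r hr hR
  have hr0 : 0 < r := by linarith
  have e : (0 : ℝ) - r / (23 / 25) = -(25 * r / 23) := by ring
  have key : |(0 : ℝ) - r / (23 / 25)| ≤ 1 + (64 : ℕ) := by
    rw [e, abs_neg, abs_of_pos (by positivity)]; push_cast; linarith
  refine ⟨?_, ?_⟩
  · rw [rightSlab_empty, finsum_mem_empty]; exact key
  · rw [leftSlab_empty, finsum_mem_empty]; exact key

/-- the zeros of `fW` seen from any `w` of the box interior: all of them. -/
theorem nearSet_eq {w : ℂ} (hw : |w.re| < 20) :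
    {u : ℂ | fW u = 0 ∧ |u.re - w.re| < 40 / 2} = ↑({0, I, -I} : Finset ℂ) := by
  ext u
  simp only [Set.mem_setOf_eq, Finset.coe_insert, Finset.coe_singleton, Set.mem_insert_iff,
    Set.mem_singleton_iff, fW_eq_zero_iff]
  constructor
  · rintro ⟨h, -⟩; exact h
  · intro h; refine ⟨h, ?_⟩
    have hw' : |0 - w.re| < 40 / 2 := by rw [zero_sub, abs_neg]; linarith
    rcases h with rfl | rfl | rfl <;> simpa using hw'

/-- on the box edge `|Re w| = 20` the near set is empty. -/
theorem nearSet_empty {w : ℂ} (hw : |w.re| = 20) :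
    {u : ℂ | fW u = 0 ∧ |u.re - w.re| < 40 / 2} = ∅ := by
  ext u
  simp only [Set.mem_setOf_eq, Set.mem_empty_iff_false, iff_false, not_and, fW_eq_zero_iff]
  have hw' : ¬ |0 - w.re| < 40 / 2 := by rw [zero_sub, abs_neg, hw]; norm_num
  rintro (rfl | rfl | rfl) <;> simpa using hw'

/-- `fW1 w = 3w²(w − i)(w + i) + 2w⁴` (the log-derivative numerator, `i`-free form). -/
theorem fW1_split (w : ℂ) : fW1 w = 3 * w ^ 2 * ((w - I) * (w + I)) + 2 * w ^ 4 := by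
  unfold fW1; linear_combination (3 * w ^ 2) * I_mul_I

/-- `fW z = z³ (z² + 1)`. -/
theorem fW_factor' (z : ℂ) : fW z = z ^ 3 * (z ^ 2 + 1) := by unfold fW; ring

/-- order of `fW` at `0` as a complex number: `3`. -/
theorem order_toNat_zero : ((analyticOrderAt fW 0).toNat : ℂ) = 3 := by
  rw [analyticOrderAt_fW_zero]; simp

/-- order of `fW` at `i` as a complex number: `1`. -/
theorem order_toNat_I : ((analyticOrderAt fW I).toNat : ℂ) = 1 := by
  rw [analyticOrderAt_fW_I]; simp

/-- order of `fW` at `−i` as a complex number: `1`. -/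
theorem order_toNat_negI : ((analyticOrderAt fW (-I)).toNat : ℂ) = 1 := by
  rw [analyticOrderAt_fW_negI]; simp

/-- `RemainderBox (1/2) fW 0 (23/25) 2 40`: remainder `0` inside the box, `‖f′/f‖ ≤ 25/46 = η/s` on its edge. -/
theorem remainder_D : RemainderBox (1 / 2) fW 0 (23 / 25) 2 40 := by
  intro w hre him hfw
  have I_ne_negI : (I : ℂ) ≠ -I := fun h => I_ne_zero (by linear_combination (1 / 2 : ℂ) * h)
  rw [sub_zero] at hre
  norm_num at hre
  have hw0 : w ≠ 0 := fun h => hfw (by rw [h]; exact fW_zero)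
  have hwI : w - I ≠ 0 := fun h => hfw (by rw [sub_eq_zero.1 h]; exact fW_I)
  have hwI' : w + I ≠ 0 := fun h => hfw (by rw [eq_neg_of_add_eq_zero_left h]; exact fW_negI)
  rcases hre.lt_or_eq with hlt | heq
  · -- interior: the near set is the whole zero set and the remainder vanishes identically
    rw [nearSet_eq hlt, finsum_mem_coe_finset, Finset.sum_insert zero_notMem_pair,
      Finset.sum_pair I_ne_negI, order_toNat_zero, order_toNat_I, order_toNat_negI, deriv_fW]
    have key : fW1 w / fW w - (3 * (w - 0)⁻¹ + (1 * (w - I)⁻¹ + 1 * (w - -I)⁻¹)) = 0 := by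
      rw [sub_zero, sub_neg_eq_add, one_mul, one_mul, fW1_split, fW_factor]
      field_simp
      ring
    rw [key, norm_zero]; norm_num
  · -- box edge `|re w| = 20`: the near set is empty; bound `‖f′/f‖ ≤ 25/46`
    rw [nearSet_empty heq, finsum_mem_empty, sub_zero, deriv_fW, norm_div]
    have ht : 20 ≤ ‖w‖ := le_trans (le_of_eq heq.symm) (abs_re_le_norm w)
    have hnum : ‖fW1 w‖ ≤ ‖w‖ ^ 2 * (5 * ‖w‖ ^ 2 + 3) := by
      rw [fW1_factor, norm_mul, norm_pow]
      gcongr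
      calc ‖5 * w ^ 2 + 3‖ ≤ ‖5 * w ^ 2‖ + ‖(3 : ℂ)‖ := norm_add_le _ _
        _ = 5 * ‖w‖ ^ 2 + 3 := by simp [norm_pow]
    have hden : ‖w‖ ^ 3 * (‖w‖ ^ 2 - 1) ≤ ‖fW w‖ := by
      rw [fW_factor', norm_mul, norm_pow]
      have h1 : ‖w‖ ^ 2 - 1 ≤ ‖w ^ 2 + 1‖ := by
        have := norm_sub_norm_le (w ^ 2) (-1)
        simpa [norm_pow, sub_neg_eq_add] using this
      exact mul_le_mul_of_nonneg_left h1 (by positivity)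
    have hpos : 0 < ‖fW w‖ := norm_pos_iff.2 hfw
    rw [div_le_iff₀ hpos]
    set t := ‖w‖ with ht_def
    have p3 : 0 ≤ 25 * t ^ 3 - 230 * t ^ 2 - 25 * t - 138 := by
      nlinarith [mul_nonneg (sub_nonneg.2 ht) (show (0 : ℝ) ≤ 25 * t ^ 2 + 270 * t + 5375 by positivity)]
    have p5 : t ^ 2 * (5 * t ^ 2 + 3) ≤ 1 / 2 / (23 / 25) * (t ^ 3 * (t ^ 2 - 1)) := by
      nlinarith [mul_nonneg (sq_nonneg t) p3]
    calc ‖fW1 w‖ ≤ t ^ 2 * (5 * t ^ 2 + 3) := hnum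
      _ ≤ 1 / 2 / (23 / 25) * (t ^ 3 * (t ^ 2 - 1)) := p5
      _ ≤ 1 / 2 / (23 / 25) * ‖fW w‖ := by gcongr

/-- growth of order `1 < 2`: `‖fW z‖ ≤ 2·exp(5‖z‖)`. -/
theorem growth_D : ∃ A' B' ρ : ℝ, ρ < 2 ∧ ∀ z : ℂ, ‖fW z‖ ≤ A' * Real.exp (B' * ‖z‖ ^ ρ) := by
  refine ⟨2, 5, 1, by norm_num, fun z => ?_⟩
  rw [Real.rpow_one]
  have h0 : 0 ≤ ‖z‖ := norm_nonneg z
  have hle : ‖z‖ ≤ Real.exp ‖z‖ := by linarith [Real.add_one_le_exp ‖z‖]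
  have h5 : ‖z‖ ^ 5 ≤ Real.exp (5 * ‖z‖) := by
    calc ‖z‖ ^ 5 ≤ Real.exp ‖z‖ ^ 5 := pow_le_pow_left₀ h0 hle 5
      _ = Real.exp (5 * ‖z‖) := by rw [← Real.exp_nat_mul]; norm_num
  have h3 : ‖z‖ ^ 3 ≤ Real.exp (5 * ‖z‖) := by
    calc ‖z‖ ^ 3 ≤ Real.exp ‖z‖ ^ 3 := pow_le_pow_left₀ h0 hle 3
      _ = Real.exp (3 * ‖z‖) := by rw [← Real.exp_nat_mul]; norm_num
      _ ≤ Real.exp (5 * ‖z‖) := Real.exp_le_exp.2 (by nlinarith)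
  calc ‖fW z‖ = ‖z ^ 5 + z ^ 3‖ := rfl
    _ ≤ ‖z ^ 5‖ + ‖z ^ 3‖ := norm_add_le _ _
    _ = ‖z‖ ^ 5 + ‖z‖ ^ 3 := by rw [norm_pow, norm_pow]
    _ ≤ 2 * Real.exp (5 * ‖z‖) := by linarith

/-- ★ the datum `D* = (1/2, fW, 0, 23/25, 2, 40, 1, 64)` satisfies `EngineHyps5 2`. -/
theorem engineHyps5_D : EngineHyps5 2 (1 / 2) fW 0 (23 / 25) 2 40 1 64 := by
  refine ⟨differentiable_fW, fun x => ?_, growth_D, by norm_num, by norm_num, by norm_num, by norm_num,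
    by norm_num, fun w hw => ?_, by norm_num, ⟨I, fW_I, by simp, by simp, by simp⟩, columnBudget_D,
    halfSlab_D, by norm_num, by norm_num, remainder_D⟩
  · unfold fW; rw [← ofReal_pow, ← ofReal_pow, ← ofReal_add, ofReal_im]
  · rcases (fW_eq_zero_iff w).1 hw with rfl | rfl | rfl <;> simp

end Summit.RiemannHypothesis.RiemannHypothesis.Theorems.TiltedLandingLaw421.Negative
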